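import Mathlib
import Summits.Ventures.CertifiedArithmetic.LowPrec.OptSearchGainSSE

/-!
# Opt / R4 — Theorems S5 (SSE) and S6 (SSE bound and attainment) for E2M1, E2M3, E3M2

HONEST FRAMING: certified error envelopes and provably optimal rounding/accumulation schemes for
low-precision formats under stated cost models; every table by two implementations; no hardware or
vendor claims.

Instances of the generic theorems of `OptSearchGainSSE.lean` for the three `Lo` grids of
`OptScaleNesting.lean` (format data, all decided by `decide`: E2M1 `T=12, Tm=6, L=4, Lm=2, w=10, R=2`;
E2M3 `T=60, Tm=30, L=16, Lm=8, w=58, R=2`; E3M2 `T=448, Tm=224, L=8, Lm=4, w=416, R=32`):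
THEOREM S6 `sse_search_gain_le_e2m1/_e2m3/_e3m2` (no power-of-two scale beats the non-clipping scale
`2u` by more than `(k-1) u²` in block SSE) and its attainment `sse_gain_attained_e2m1/_e2m3/_e3m2`
(block `((T+1) u, u, …, u)`); THEOREM S5 (SSE) `ceil_minimax_sse_e2m1/_e2m3/_e3m2` (the non-clipping
amax rule is minimax-optimal among all power-of-two scales for the SSE objective). In OPTIMA.md units
(`δ` = finest step of the non-clipping window, `s` = its scale): gain `≤ (k-1)(δ/2)²`, i.e.
`< Γ_F(k) amax²` with `Γ_E2M1(32) = 0.215`, `Γ_E2M3(32) = 8.6e-3`, `Γ_E3M2(32) = 1.5e-4` (certificate C5,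
certs/opt/mxscale_{A,B}.json, two implementations, 0 mismatches). Proofs: OPTIMA.md §S (opt seat).
-/

namespace Summit.Ventures.CertifiedArithmetic.LowPrec.Opt

section SSEGainInstances

variable {K : Type*} [Field K] [LinearOrder K] [IsStrictOrderedRing K]

/-- **Theorem S6 for E2M1: no power-of-two scale `v` beats the non-clipping scale `2u`
(`12 u < a ≤ 24 u`) by more than `(k-1) u²` in block SSE** (`u` = half the finest spacing of the
non-clipping grid; the bound is attained, OPTIMA.md Theorem S6 / certificate C5). -/
theorem sse_search_gain_le_e2m1 {k : ℕ} (x : Fin k → K) {u a : K} (hu : 0 < u) (hx0 : ∀ i, 0 ≤ x i)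
    (hxa : ∀ i, x i ≤ a) (ha : a ≤ ((12 : ℕ) : K) * (2 * u)) (ha' : ((12 : ℕ) : K) * u < a)
    (i₀ : Fin k) (hi₀ : x i₀ = a) (v : K)
    (hv : (∃ n : ℕ, v = 2 ^ n * (2 * u)) ∨ v = u ∨ (∃ n : ℕ, 2 ≤ n ∧ v = 2 * u / 2 ^ n)) :
    blockSSE e2m1Lo_ne (2 * u) x ≤ blockSSE e2m1Lo_ne v x + ((k : K) - 1) * u ^ 2 := by
  have h2u : 0 < 2 * u := by positivity
  have hk : (1 : K) ≤ k := by exact_mod_cast Fin.pos i₀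
  have hk0 : 0 ≤ ((k : K) - 1) * u ^ 2 := by nlinarith
  have hLi : ((4 : ℕ) : K) * u ≤ x i₀ := by rw [hi₀]; push_cast at ha' ⊢; linarith
  have gen : ∀ j : ℕ, blockSSE e2m1Lo_ne (2 * u) x ≤ blockSSE e2m1Lo_ne (u / 2 ^ j) x + ((k : K) - 1) * u ^ 2 :=
    fun j => sse_gain_le e2m1Lo_ne (T := 12) (Tm := 6) (L := 4) (Lm := 2) (by decide) (by decide)
      (by decide) (by norm_num) (by decide) (by decide) (by norm_num) (by decide) (by decide)
      (fun u y hu hy0 hy => e2m1_lowcov hu hy0 (by simpa using hy)) x hu hx0 i₀ hLi j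
  rcases hv with ⟨n, rfl⟩ | rfl | ⟨n, hn, rfl⟩
  · have := sse_coarser_le e2m1Lo_ne (T := 12) (by decide) (by decide) x h2u
      (fun i => (hxa i).trans ha) n
    linarith
  · simpa using gen 0
  · obtain ⟨m, rfl⟩ := Nat.exists_eq_add_of_le hn
    have e : 2 * u / 2 ^ (2 + m) = u / 2 ^ (m + 1) := by
      rw [pow_add, pow_succ]; field_simp; ring
    rw [e]
    exact gen (m + 1)

/-- **Theorem S6 for E2M3: no power-of-two scale `v` beats the non-clipping scale `2u`
(`60 u < a ≤ 120 u`) by more than `(k-1) u²` in block SSE** (`u` = half the finest spacing of the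
non-clipping grid; the bound is attained, OPTIMA.md Theorem S6 / certificate C5). -/
theorem sse_search_gain_le_e2m3 {k : ℕ} (x : Fin k → K) {u a : K} (hu : 0 < u) (hx0 : ∀ i, 0 ≤ x i)
    (hxa : ∀ i, x i ≤ a) (ha : a ≤ ((60 : ℕ) : K) * (2 * u)) (ha' : ((60 : ℕ) : K) * u < a)
    (i₀ : Fin k) (hi₀ : x i₀ = a) (v : K)
    (hv : (∃ n : ℕ, v = 2 ^ n * (2 * u)) ∨ v = u ∨ (∃ n : ℕ, 2 ≤ n ∧ v = 2 * u / 2 ^ n)) :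
    blockSSE e2m3Lo_ne (2 * u) x ≤ blockSSE e2m3Lo_ne v x + ((k : K) - 1) * u ^ 2 := by
  have h2u : 0 < 2 * u := by positivity
  have hk : (1 : K) ≤ k := by exact_mod_cast Fin.pos i₀
  have hk0 : 0 ≤ ((k : K) - 1) * u ^ 2 := by nlinarith
  have hLi : ((16 : ℕ) : K) * u ≤ x i₀ := by rw [hi₀]; push_cast at ha' ⊢; linarith
  have gen : ∀ j : ℕ, blockSSE e2m3Lo_ne (2 * u) x ≤ blockSSE e2m3Lo_ne (u / 2 ^ j) x + ((k : K) - 1) * u ^ 2 :=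
    fun j => sse_gain_le e2m3Lo_ne (T := 60) (Tm := 30) (L := 16) (Lm := 8) (by decide) (by decide)
      (by decide) (by norm_num) (by decide) (by decide) (by norm_num) (by decide) (by decide)
      (fun u y hu hy0 hy => e2m3_lowcov hu hy0 (by simpa using hy)) x hu hx0 i₀ hLi j
  rcases hv with ⟨n, rfl⟩ | rfl | ⟨n, hn, rfl⟩
  · have := sse_coarser_le e2m3Lo_ne (T := 60) (by decide) (by decide) x h2u
      (fun i => (hxa i).trans ha) n
    linarith
  · simpa using gen 0
  · obtain ⟨m, rfl⟩ := Nat.exists_eq_add_of_le hn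
    have e : 2 * u / 2 ^ (2 + m) = u / 2 ^ (m + 1) := by
      rw [pow_add, pow_succ]; field_simp; ring
    rw [e]
    exact gen (m + 1)

/-- **Theorem S6 for E3M2: no power-of-two scale `v` beats the non-clipping scale `2u`
(`448 u < a ≤ 896 u`) by more than `(k-1) u²` in block SSE** (`u` = half the finest spacing of the
non-clipping grid; the bound is attained, OPTIMA.md Theorem S6 / certificate C5). -/
theorem sse_search_gain_le_e3m2 {k : ℕ} (x : Fin k → K) {u a : K} (hu : 0 < u) (hx0 : ∀ i, 0 ≤ x i)
    (hxa : ∀ i, x i ≤ a) (ha : a ≤ ((448 : ℕ) : K) * (2 * u)) (ha' : ((448 : ℕ) : K) * u < a)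
    (i₀ : Fin k) (hi₀ : x i₀ = a) (v : K)
    (hv : (∃ n : ℕ, v = 2 ^ n * (2 * u)) ∨ v = u ∨ (∃ n : ℕ, 2 ≤ n ∧ v = 2 * u / 2 ^ n)) :
    blockSSE e3m2Lo_ne (2 * u) x ≤ blockSSE e3m2Lo_ne v x + ((k : K) - 1) * u ^ 2 := by
  have h2u : 0 < 2 * u := by positivity
  have hk : (1 : K) ≤ k := by exact_mod_cast Fin.pos i₀
  have hk0 : 0 ≤ ((k : K) - 1) * u ^ 2 := by nlinarith
  have hLi : ((8 : ℕ) : K) * u ≤ x i₀ := by rw [hi₀]; push_cast at ha' ⊢; linarith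
  have gen : ∀ j : ℕ, blockSSE e3m2Lo_ne (2 * u) x ≤ blockSSE e3m2Lo_ne (u / 2 ^ j) x + ((k : K) - 1) * u ^ 2 :=
    fun j => sse_gain_le e3m2Lo_ne (T := 448) (Tm := 224) (L := 8) (Lm := 4) (by decide) (by decide)
      (by decide) (by norm_num) (by decide) (by decide) (by norm_num) (by decide) (by decide)
      (fun u y hu hy0 hy => e3m2_lowcov hu hy0 (by simpa using hy)) x hu hx0 i₀ hLi j
  rcases hv with ⟨n, rfl⟩ | rfl | ⟨n, hn, rfl⟩
  · have := sse_coarser_le e3m2Lo_ne (T := 448) (by decide) (by decide) x h2u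
      (fun i => (hxa i).trans ha) n
    linarith
  · simpa using gen 0
  · obtain ⟨m, rfl⟩ := Nat.exists_eq_add_of_le hn
    have e : 2 * u / 2 ^ (2 + m) = u / 2 ^ (m + 1) := by
      rw [pow_add, pow_succ]; field_simp; ring
    rw [e]
    exact gen (m + 1)

/-- **Theorem S6 attainment for E2M1:** the bound `(k-1) u²` is attained (block `(13 u, u, …, u)`). -/
theorem sse_gain_attained_e2m1 {k : ℕ} (hk : 1 ≤ k) {u : K} (hu : 0 < u) :
    ∃ (x : Fin k → K) (i₀ : Fin k), (∀ i, 0 ≤ x i) ∧ (∀ i, x i ≤ x i₀) ∧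
      ((12 : ℕ) : K) * u < x i₀ ∧ x i₀ ≤ ((12 : ℕ) : K) * (2 * u) ∧
      blockSSE e2m1Lo_ne (2 * u) x = blockSSE e2m1Lo_ne u x + ((k : K) - 1) * u ^ 2 :=
  sse_gain_attained e2m1Lo_ne (T := 12) (Tm := 6) (by decide) (by norm_num) (by decide) (by decide) (by decide)
    (by decide) (by decide) (by decide) hk hu

/-- **Theorem S6 attainment for E2M3:** the bound `(k-1) u²` is attained (block `(61 u, u, …, u)`). -/
theorem sse_gain_attained_e2m3 {k : ℕ} (hk : 1 ≤ k) {u : K} (hu : 0 < u) :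
    ∃ (x : Fin k → K) (i₀ : Fin k), (∀ i, 0 ≤ x i) ∧ (∀ i, x i ≤ x i₀) ∧
      ((60 : ℕ) : K) * u < x i₀ ∧ x i₀ ≤ ((60 : ℕ) : K) * (2 * u) ∧
      blockSSE e2m3Lo_ne (2 * u) x = blockSSE e2m3Lo_ne u x + ((k : K) - 1) * u ^ 2 :=
  sse_gain_attained e2m3Lo_ne (T := 60) (Tm := 30) (by decide) (by norm_num) (by decide) (by decide) (by decide)
    (by decide) (by decide) (by decide) hk hu

/-- **Theorem S6 attainment for E3M2:** the bound `(k-1) u²` is attained (block `(449 u, u, …, u)`). -/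
theorem sse_gain_attained_e3m2 {k : ℕ} (hk : 1 ≤ k) {u : K} (hu : 0 < u) :
    ∃ (x : Fin k → K) (i₀ : Fin k), (∀ i, 0 ≤ x i) ∧ (∀ i, x i ≤ x i₀) ∧
      ((448 : ℕ) : K) * u < x i₀ ∧ x i₀ ≤ ((448 : ℕ) : K) * (2 * u) ∧
      blockSSE e3m2Lo_ne (2 * u) x = blockSSE e3m2Lo_ne u x + ((k : K) - 1) * u ^ 2 :=
  sse_gain_attained e3m2Lo_ne (T := 448) (Tm := 224) (by decide) (by norm_num) (by decide) (by decide) (by decide)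
    (by decide) (by decide) (by decide) hk hu

/-- **Theorem S5 (SSE) for E2M1: the non-clipping power-of-two scale `2u` (`12 u < a ≤ 24 u`) is
minimax-optimal among ALL power-of-two scales for the SSE objective** (every block is matched by a block
with the same maximum doing at least as badly at scale `v`). -/
theorem ceil_minimax_sse_e2m1 {k : ℕ} (x : Fin k → K) {u a : K} (hu : 0 < u) (hx0 : ∀ i, 0 ≤ x i)
    (hxa : ∀ i, x i ≤ a) (ha : a ≤ ((12 : ℕ) : K) * (2 * u)) (ha' : ((12 : ℕ) : K) * u < a)
    (i₀ : Fin k) (hi₀ : x i₀ = a) (v : K)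
    (hv : (∃ n : ℕ, v = 2 ^ n * (2 * u)) ∨ v = u ∨ (∃ n : ℕ, 2 ≤ n ∧ v = 2 * u / 2 ^ n)) :
    ∃ x' : Fin k → K, (∀ i, 0 ≤ x' i) ∧ (∀ i, x' i ≤ a) ∧ x' i₀ = a ∧
      blockSSE e2m1Lo_ne (2 * u) x ≤ blockSSE e2m1Lo_ne v x' := by
  have h2u : 0 < 2 * u := by positivity
  have ha2 : ((12 : ℕ) : K) * (2 * u) < 2 * a := by linarith
  rcases hv with ⟨n, rfl⟩ | rfl | ⟨n, hn, rfl⟩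
  · exact ⟨x, hx0, hxa, hi₀, sse_coarser_le e2m1Lo_ne (T := 12) (by decide) (by decide) x h2u
      (fun i => (hxa i).trans ha) n⟩
  · exact ceil_vs_half_sse e2m1Lo_ne (T := 12) (Tm := 6) (L := 4) (Lm := 2) (w := 10) (R := 2)
      (by decide) (by decide) (by decide) (by norm_num) (by decide) (by decide) (by norm_num) (by decide)
      (by decide) (fun u y hu hy0 hy => e2m1_lowcov hu hy0 (by simpa using hy))
      (fun u y hu hy0 hy => by simpa using e2m1_cov hu hy0 (by simpa using hy)) (by norm_num) (by norm_num)
      (by decide) x hu hx0 hxa ha' i₀ hi₀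
  · refine ⟨fun _ => a, fun _ => by linarith [hx0 i₀, hxa i₀], fun _ => le_rfl, rfl, ?_⟩
    exact finer_sse_const e2m1Lo_ne (T := 12) (by decide) (R := 2) (by norm_num)
      (fun s y hs hy0 hy => e2m1_cov hs hy0 (by simpa using hy)) x h2u hx0 hxa ha ha2 hn

/-- **Theorem S5 (SSE) for E2M3: the non-clipping power-of-two scale `2u` (`60 u < a ≤ 120 u`) is
minimax-optimal among ALL power-of-two scales for the SSE objective** (every block is matched by a block
with the same maximum doing at least as badly at scale `v`). -/
theorem ceil_minimax_sse_e2m3 {k : ℕ} (x : Fin k → K) {u a : K} (hu : 0 < u) (hx0 : ∀ i, 0 ≤ x i)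
    (hxa : ∀ i, x i ≤ a) (ha : a ≤ ((60 : ℕ) : K) * (2 * u)) (ha' : ((60 : ℕ) : K) * u < a)
    (i₀ : Fin k) (hi₀ : x i₀ = a) (v : K)
    (hv : (∃ n : ℕ, v = 2 ^ n * (2 * u)) ∨ v = u ∨ (∃ n : ℕ, 2 ≤ n ∧ v = 2 * u / 2 ^ n)) :
    ∃ x' : Fin k → K, (∀ i, 0 ≤ x' i) ∧ (∀ i, x' i ≤ a) ∧ x' i₀ = a ∧
      blockSSE e2m3Lo_ne (2 * u) x ≤ blockSSE e2m3Lo_ne v x' := by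
  have h2u : 0 < 2 * u := by positivity
  have ha2 : ((60 : ℕ) : K) * (2 * u) < 2 * a := by linarith
  rcases hv with ⟨n, rfl⟩ | rfl | ⟨n, hn, rfl⟩
  · exact ⟨x, hx0, hxa, hi₀, sse_coarser_le e2m3Lo_ne (T := 60) (by decide) (by decide) x h2u
      (fun i => (hxa i).trans ha) n⟩
  · exact ceil_vs_half_sse e2m3Lo_ne (T := 60) (Tm := 30) (L := 16) (Lm := 8) (w := 58) (R := 2)
      (by decide) (by decide) (by decide) (by norm_num) (by decide) (by decide) (by norm_num) (by decide)
      (by decide) (fun u y hu hy0 hy => e2m3_lowcov hu hy0 (by simpa using hy))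
      (fun u y hu hy0 hy => by simpa using e2m3_cov hu hy0 (by simpa using hy)) (by norm_num) (by norm_num)
      (by decide) x hu hx0 hxa ha' i₀ hi₀
  · refine ⟨fun _ => a, fun _ => by linarith [hx0 i₀, hxa i₀], fun _ => le_rfl, rfl, ?_⟩
    exact finer_sse_const e2m3Lo_ne (T := 60) (by decide) (R := 2) (by norm_num)
      (fun s y hs hy0 hy => e2m3_cov hs hy0 (by simpa using hy)) x h2u hx0 hxa ha ha2 hn

/-- **Theorem S5 (SSE) for E3M2: the non-clipping power-of-two scale `2u` (`448 u < a ≤ 896 u`) is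
minimax-optimal among ALL power-of-two scales for the SSE objective** (every block is matched by a block
with the same maximum doing at least as badly at scale `v`). -/
theorem ceil_minimax_sse_e3m2 {k : ℕ} (x : Fin k → K) {u a : K} (hu : 0 < u) (hx0 : ∀ i, 0 ≤ x i)
    (hxa : ∀ i, x i ≤ a) (ha : a ≤ ((448 : ℕ) : K) * (2 * u)) (ha' : ((448 : ℕ) : K) * u < a)
    (i₀ : Fin k) (hi₀ : x i₀ = a) (v : K)
    (hv : (∃ n : ℕ, v = 2 ^ n * (2 * u)) ∨ v = u ∨ (∃ n : ℕ, 2 ≤ n ∧ v = 2 * u / 2 ^ n)) :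
    ∃ x' : Fin k → K, (∀ i, 0 ≤ x' i) ∧ (∀ i, x' i ≤ a) ∧ x' i₀ = a ∧
      blockSSE e3m2Lo_ne (2 * u) x ≤ blockSSE e3m2Lo_ne v x' := by
  have h2u : 0 < 2 * u := by positivity
  have ha2 : ((448 : ℕ) : K) * (2 * u) < 2 * a := by linarith
  rcases hv with ⟨n, rfl⟩ | rfl | ⟨n, hn, rfl⟩
  · exact ⟨x, hx0, hxa, hi₀, sse_coarser_le e3m2Lo_ne (T := 448) (by decide) (by decide) x h2u
      (fun i => (hxa i).trans ha) n⟩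
  · exact ceil_vs_half_sse e3m2Lo_ne (T := 448) (Tm := 224) (L := 8) (Lm := 4) (w := 416) (R := 32)
      (by decide) (by decide) (by decide) (by norm_num) (by decide) (by decide) (by norm_num) (by decide)
      (by decide) (fun u y hu hy0 hy => e3m2_lowcov hu hy0 (by simpa using hy))
      (fun u y hu hy0 hy => by simpa using e3m2_cov hu hy0 (by simpa using hy)) (by norm_num) (by norm_num)
      (by decide) x hu hx0 hxa ha' i₀ hi₀
  · refine ⟨fun _ => a, fun _ => by linarith [hx0 i₀, hxa i₀], fun _ => le_rfl, rfl, ?_⟩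
    exact finer_sse_const e3m2Lo_ne (T := 448) (by decide) (R := 32) (by norm_num)
      (fun s y hs hy0 hy => e3m2_cov hs hy0 (by simpa using hy)) x h2u hx0 hxa ha ha2 hn

end SSEGainInstances

end Summit.Ventures.CertifiedArithmetic.LowPrec.Opt
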